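import Summits.QuantumFields.YangMills.Theorems.PoincareLipschitzLeungXinTwistedGraphStability

/-!
# Crux `HistoryTailL` (stmt-QuantumFields-19936), K2 organ of record `hReg` = «LOC-REG-MIN» (route crux `PoincareLipschitz.BlockLipschitzL`, stmt-QuantumFields-23533):
# THE SHARP TWISTED STABILITY INEQUALITY — the flat Leung–Xin constant `3` survives the twist up to `ε`, at the price `(8∕ε)` on the volume term

Cell `ym3-torus` (YM ladder rung R3 = continuum SU(2) Yang–Mills on the three-torus — a RUNG, NOT the Clay problem: not d = 4, not infinite volume, not a
mass gap), TWIN-WIDTH seat `ym-ust-19936-w8` gen 6 (LEAD `ym-ust-19936-w1` g8 2026-08-29T05:13:52Z «w8: (a) GO»; filed as its OWN file rather than v1.1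
appends because ✓`…TwistedIdentity` (333 l.) and ✓`…TwistedGraphStability` (305 l.) would both pass the 400-line lint); `--supports stmt-QuantumFields-19936
--as helper`; THEOREMS ONLY, definition-free; imports ✓p698045 `…TwistedGraphStability` (hence ✓p696746, ✓p696762, ✓p695660) only.

WHY.  ✓`secondVariation_twist_le` traded the first-order twist term `c·(p−q)·(Sq−q)` against HALF the bond energy (`4√e·F ≤ e + 4F²`), so the summed
twisted inequality ✓`twisted_graph_stability` carries the cutoff constant `6` against `Σηη·e·(1+e)` — a factor `2` off the FLAT ✓`graph_stability`
(`Σηη·e·(1+e∕2) ≤ 3·Σc(η_x−η_y)²`).  For the growth bound the factor is immaterial; for the located GAP test it is not: with the log cutoff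
`η = (r₁∕|x−x₀|)^{1∕2}` the sharp constant `3` gives log-averaged normalised shell energy `≤ 3π`, against `≥ 8π` for persistent conical concentration on a
non-constant harmonic `S² → S³` (conformal, energy `= 2·area ≥ 8π`) — Schoen–Uhlenbeck's tangent-map test at `d(3) = 3` (LEAD card v1.39: «the residue's
sharp form»); with the constant `6` the margin `8π > 6π` is thin and dies under the twist's volume term.  Hence this file: the `ε`-weighted Young
inequality `4|(p−q)·(Sq−q)| ≤ (ε∕2)|p−q|² + (8∕ε)|Sq−q|²` keeps `2 − ε∕2` of the energy,

  per bond:  `6c(α²+β²) − 4αβ·X(S) ≤ 6c(α−β)² − αβ·e·(2 − ε∕2 + e) + αβ·(4(4 − tr S) + (8∕ε)|Sq − q|²)`   (`secondVariation_twist_le_eps`),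
  summed:    `Σ_b η_xη_y·e_b·(2 − ε∕2 + e_b) ≤ Σ_b [6c_b(η_x−η_y)² + η_xη_y·(4(4 − tr S_b) + (8∕ε)|S_bq_b − q_b|²)]`   (`twisted_graph_stability_eps`),

i.e. `Σ ηη·e·(1 − ε∕4 + e∕2) ≤ 3·Σ c(η_x−η_y)² + Σ ηη·(2(4 − tr S_b) + (4∕ε)|S_bq_b−q_b|²)` — the flat `3` up to `ε`.  On the way the summed second
variation `0 ≤ Σ_b [6c_b(η_x²+η_y²) − 4η_xη_yX(S_b)]` (Steps 1–2 of ✓`twisted_graph_stability`) is exported as `sum_twisted_secondVariation_nonneg`.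

WHAT (ns `…Theorems.PoincareLipschitzLeungXinTwistedSharp`; letters of ✓FILE 2∕2b: `Fin 4 → ℝ`, `dotProduct`, twists `S b` with `S b * (S b)ᵀ = 1`
acting by `(S b)ᵀ *ᵥ` on the target end).
* §1 ★★`four_mul_deviation_le_eps`, ★★`secondVariation_twist_le_eps`.
* §2 ★★`sum_twisted_secondVariation_nonneg`, ★★★`twisted_graph_stability_eps`.
HONEST SCOPE.  Finite-dimensional algebra over the landed stability letters; nothing of `hReg`∕LOC-REG-MIN, the charts, `BlockLipschitzL`, `HistoryTailL`, the
gap test itself or any summit statement is proved.  YM₃ on T³ is rung R3, NOT the Clay problem.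

References: Y. L. Xin, Duke Math. J. **47** (1980) 609–613 [Xin1980]; R. Schoen, K. Uhlenbeck, J. Differential Geom. **17** (1982) 307–335 [SchoenUhlenbeck1982]
(§2: minimising tangent maps into `S³` from dimension 3 are constant); T. Kajigaya, Ann. Mat. Pura Appl. (2023) Thm 1.2; T. Bałaban, Commun. Math. Phys. **98**
(1985) 17–51 [Balaban1985Averaging] (§3).
-/

set_option autoImplicit false

open scoped BigOperators
open Finset Matrix

namespace Summit.QuantumFields.YangMills.Theorems.PoincareLipschitzLeungXinTwistedSharp

open Summit.QuantumFields.YangMills.Theorems.PoincareLipschitzLeungXinSphereIdentity (single_dot)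
open Summit.QuantumFields.YangMills.Theorems.PoincareLipschitzLeungXinTwistedIdentity (transpose_mul_self_of_mul_transpose_self
  mulVec_dot_mulVec sum_bondHessian_twist_eq crossSum_twist_eq normSq_sub_eq)
open Summit.QuantumFields.YangMills.Theorems.PoincareLipschitzLeungXinGraphStability (sum_hessianForm_nonpos_of_forall_dot_le)
open Summit.QuantumFields.YangMills.Theorems.PoincareLipschitzLeungXinTwistedGraphStability (transpose_mulVec_dot transpose_mulVec_tang
  transpose_mulVec_varPt)

/-! ## §1 The SHARP twisted per-bond form: an `ε`-weighted trade keeps `2 − ε∕2` of the energy -/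

/-- ★★ **THE DEVIATION WITH AN `ε`-WEIGHT** (orthogonal `S`, unit `p, q`, `0 < ε`): `4·(2 + c² − X(S)) ≤ 4(4 − Σ_a S_{aa}) + (8∕ε)·|Sq − q|² + (ε∕2)·e`
— the same split as ✓`four_mul_deviation_le` but with `|(p−q)·(Sq−q)| ≤ (ε∕8)e + (2∕ε)|Sq−q|²`, so only the fraction `ε∕2` of the bond energy is spent
on the first-order twist term (needed wherever the SHARP stability constant matters, e.g. a log-cutoff ∕ tangent-map gap). [folklore] -/
theorem four_mul_deviation_le_eps {S : Matrix (Fin 4) (Fin 4) ℝ} (hS : S * Sᵀ = 1) (p q : Fin 4 → ℝ) (hp : dotProduct p p = 1)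
    (hq : dotProduct q q = 1) {ε : ℝ} (hε : 0 < ε) :
    4 * (2 + dotProduct p q ^ 2 -
        (∑ a : Fin 4, S a a - dotProduct (S *ᵥ q) q - dotProduct p (S *ᵥ p) + dotProduct p q * dotProduct p (S *ᵥ q))) ≤
      4 * (4 - ∑ a : Fin 4, S a a) + 8 / ε * dotProduct (S *ᵥ q - q) (S *ᵥ q - q) + ε / 2 * dotProduct (p - q) (p - q) := by
  rw [crossSum_twist_eq hS p q hp hq]
  have hw : dotProduct (S *ᵥ q) (S *ᵥ q) = 1 := by rw [mulVec_dot_mulVec hS, hq]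
  have hqw : dotProduct q (S *ᵥ q - q) = -(1 / 2) * dotProduct (S *ᵥ q - q) (S *ᵥ q - q) := by
    rw [dotProduct_sub, sub_dotProduct, dotProduct_sub, dotProduct_sub, hw, hq, dotProduct_comm q (S *ᵥ q)]
    ring
  have hsplit : dotProduct p (S *ᵥ q - q) = dotProduct (p - q) (S *ᵥ q - q) + dotProduct q (S *ᵥ q - q) := by
    rw [sub_dotProduct]; ring
  have hu0 : 0 ≤ dotProduct (S *ᵥ p - p) (S *ᵥ p - p) := by
    show 0 ≤ ∑ i, (S *ᵥ p - p) i * (S *ᵥ p - p) i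
    exact Finset.sum_nonneg fun i _ => mul_self_nonneg _
  have hw0 : 0 ≤ dotProduct (S *ᵥ q - q) (S *ᵥ q - q) := by
    show 0 ≤ ∑ i, (S *ᵥ q - q) i * (S *ᵥ q - q) i
    exact Finset.sum_nonneg fun i _ => mul_self_nonneg _
  have hd0 : 0 ≤ dotProduct (p - q) (p - q) := by
    show 0 ≤ ∑ i, (p - q) i * (p - q) i
    exact Finset.sum_nonneg fun i _ => mul_self_nonneg _
  -- `|c| ≤ 1`
  have hc : |dotProduct p q| ≤ 1 := by
    rw [← sq_le_one_iff_abs_le_one]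
    have h := Finset.sum_mul_sq_le_sq_mul_sq (Finset.univ : Finset (Fin 4)) p q
    have hp' : ∑ i : Fin 4, p i ^ 2 = 1 := by
      rw [← hp]; exact Finset.sum_congr rfl fun i _ => sq (p i)
    have hq' : ∑ i : Fin 4, q i ^ 2 = 1 := by
      rw [← hq]; exact Finset.sum_congr rfl fun i _ => sq (q i)
    rw [hp', hq', mul_one] at h
    exact h
  -- the `ε`-weighted Young inequality, pre-multiplied by `4`: `4|(p − q)·w| ≤ (ε∕2)|p − q|² + (8∕ε)|w|²`
  have ht4 : 4 * |dotProduct (p - q) (S *ᵥ q - q)| ≤ ε / 2 * dotProduct (p - q) (p - q) + 8 / ε * dotProduct (S *ᵥ q - q) (S *ᵥ q - q) := by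
    have hcs := Finset.sum_mul_sq_le_sq_mul_sq (Finset.univ : Finset (Fin 4)) (p - q) (S *ᵥ q - q)
    have hd : ∑ i : Fin 4, (p - q) i ^ 2 = dotProduct (p - q) (p - q) := Finset.sum_congr rfl fun i _ => sq _
    have hw' : ∑ i : Fin 4, (S *ᵥ q - q) i ^ 2 = dotProduct (S *ᵥ q - q) (S *ᵥ q - q) := Finset.sum_congr rfl fun i _ => sq _
    rw [hd, hw'] at hcs
    have hprod : (ε / 2 * dotProduct (p - q) (p - q)) * (8 / ε * dotProduct (S *ᵥ q - q) (S *ᵥ q - q)) =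
        4 * (dotProduct (p - q) (p - q) * dotProduct (S *ᵥ q - q) (S *ᵥ q - q)) := by
      field_simp
      ring
    have hcs' : dotProduct (p - q) (S *ᵥ q - q) ^ 2 ≤ dotProduct (p - q) (p - q) * dotProduct (S *ᵥ q - q) (S *ᵥ q - q) := hcs
    have h4 : |4 * dotProduct (p - q) (S *ᵥ q - q)| ≤ ε / 2 * dotProduct (p - q) (p - q) + 8 / ε * dotProduct (S *ᵥ q - q) (S *ᵥ q - q) := by
      refine abs_le_of_sq_le_sq ?_ (by positivity)
      calc (4 * dotProduct (p - q) (S *ᵥ q - q)) ^ 2 = 16 * dotProduct (p - q) (S *ᵥ q - q) ^ 2 := by ring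
        _ ≤ 16 * (dotProduct (p - q) (p - q) * dotProduct (S *ᵥ q - q) (S *ᵥ q - q)) := by linarith [hcs']
        _ = 4 * ((ε / 2 * dotProduct (p - q) (p - q)) * (8 / ε * dotProduct (S *ᵥ q - q) (S *ᵥ q - q))) := by rw [hprod]; ring
        _ ≤ (ε / 2 * dotProduct (p - q) (p - q) + 8 / ε * dotProduct (S *ᵥ q - q) (S *ᵥ q - q)) ^ 2 := by
            nlinarith [sq_nonneg (ε / 2 * dotProduct (p - q) (p - q) - 8 / ε * dotProduct (S *ᵥ q - q) (S *ᵥ q - q))]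
    rw [abs_mul, abs_of_pos (by norm_num : (0 : ℝ) < 4)] at h4
    exact h4
  have hct : -(dotProduct p q * dotProduct (p - q) (S *ᵥ q - q)) ≤ |dotProduct (p - q) (S *ᵥ q - q)| := by
    have h1 := neg_abs_le (dotProduct p q * dotProduct (p - q) (S *ᵥ q - q))
    rw [abs_mul] at h1
    have h2 : |dotProduct p q| * |dotProduct (p - q) (S *ᵥ q - q)| ≤ |dotProduct (p - q) (S *ᵥ q - q)| :=
      mul_le_of_le_one_left (abs_nonneg _) hc
    linarith
  have hcw : dotProduct p q * dotProduct (S *ᵥ q - q) (S *ᵥ q - q) ≤ dotProduct (S *ᵥ q - q) (S *ᵥ q - q) :=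
    mul_le_of_le_one_left hw0 (abs_le.mp hc).2
  have hdist : dotProduct p q * (dotProduct (p - q) (S *ᵥ q - q) + -(1 / 2) * dotProduct (S *ᵥ q - q) (S *ᵥ q - q)) =
      dotProduct p q * dotProduct (p - q) (S *ᵥ q - q) - (1 / 2) * (dotProduct p q * dotProduct (S *ᵥ q - q) (S *ᵥ q - q)) := by ring
  rw [hsplit, hqw, hdist]
  linarith [hu0, hw0, ht4, hct, hcw, hd0]

/-- ★★ **THE SHARP TWISTED SECOND VARIATION, PER BOND** (`α, β ≥ 0`, `0 < ε`):
`6c(α² + β²) − 4αβ·X(S) ≤ 6c(α − β)² − αβ·e·(2 − ε∕2 + e) + αβ·(4(4 − Σ_a S_{aa}) + (8∕ε)|S q − q|²)` — the flat energy coefficient `2` of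
✓`sum_secondVariation_eq` survives up to `ε∕2` (✓`secondVariation_twist_le` is the `ε`-free trade keeping only `1`), at the price `(8∕ε)` on the volume term.
Summed under stability this is `Σ η_xη_y e_b(1 − ε∕4 + e_b∕2) ≤ 3Σ c_b(η_x−η_y)² + Σ η_xη_y(2(4 − tr S_b) + (4∕ε)|S_bq_b − q_b|²)` — the constant `3` of
✓`graph_stability`. [cite: Xin1980, p.609–613] -/
theorem secondVariation_twist_le_eps {S : Matrix (Fin 4) (Fin 4) ℝ} (hS : S * Sᵀ = 1) (p q : Fin 4 → ℝ) (hp : dotProduct p p = 1)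
    (hq : dotProduct q q = 1) {α β : ℝ} (hα : 0 ≤ α) (hβ : 0 ≤ β) {ε : ℝ} (hε : 0 < ε) :
    6 * dotProduct p q * (α ^ 2 + β ^ 2) -
        4 * α * β * (∑ a : Fin 4, S a a - dotProduct (S *ᵥ q) q - dotProduct p (S *ᵥ p) + dotProduct p q * dotProduct p (S *ᵥ q)) ≤
      6 * dotProduct p q * (α - β) ^ 2 - α * β * dotProduct (p - q) (p - q) * (2 - ε / 2 + dotProduct (p - q) (p - q)) +
        α * β * (4 * (4 - ∑ a : Fin 4, S a a) + 8 / ε * dotProduct (S *ᵥ q - q) (S *ᵥ q - q)) := by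
  have hdev := mul_le_mul_of_nonneg_left (four_mul_deviation_le_eps hS p q hp hq hε) (mul_nonneg hα hβ)
  have he := normSq_sub_eq p q hp hq
  rw [he] at hdev ⊢
  nlinarith [hdev]


/-! ## §2 The exported stability form and the SHARP-constant graph inequality -/

/-- ★★ **THE TWISTED SECOND VARIATION IS NON-NEGATIVE AT A MINIMISER (exported).**  Under `twisted_graph_stability`'s minimality hypothesis along the
four Leung–Xin curves, `0 ≤ Σ_b [6c_b(η_x² + η_y²) − 4η_xη_y·X(S_b)]` — Steps 1–2 of ✓`twisted_graph_stability`, now a letter any per-bond trade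
(✓`secondVariation_twist_le`, ✓`secondVariation_twist_le_eps`) can be summed against. [cite: Xin1980, p.609–613] -/
theorem sum_twisted_secondVariation_nonneg {V B : Type*} [Fintype B] (src tgt : B → V) (u : V → Fin 4 → ℝ)
    (hu : ∀ x, dotProduct (u x) (u x) = 1) (S : B → Matrix (Fin 4) (Fin 4) ℝ) (hS : ∀ b, S b * (S b)ᵀ = 1) (η : V → ℝ)
    (hmin : ∀ (a : Fin 4) (t : ℝ),
      ∑ b, dotProduct
        ((Real.sqrt (1 + t ^ 2 * dotProduct (η (src b) • (Pi.single a 1 - dotProduct (Pi.single a 1) (u (src b)) • u (src b)))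
            (η (src b) • (Pi.single a 1 - dotProduct (Pi.single a 1) (u (src b)) • u (src b)))))⁻¹ •
          (u (src b) + t • (η (src b) • (Pi.single a 1 - dotProduct (Pi.single a 1) (u (src b)) • u (src b)))))
        ((S b)ᵀ *ᵥ ((Real.sqrt (1 + t ^ 2 * dotProduct (η (tgt b) • (Pi.single a 1 - dotProduct (Pi.single a 1) (u (tgt b)) • u (tgt b)))
            (η (tgt b) • (Pi.single a 1 - dotProduct (Pi.single a 1) (u (tgt b)) • u (tgt b)))))⁻¹ •
          (u (tgt b) + t • (η (tgt b) • (Pi.single a 1 - dotProduct (Pi.single a 1) (u (tgt b)) • u (tgt b)))))) ≤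
      ∑ b, dotProduct (u (src b)) ((S b)ᵀ *ᵥ u (tgt b))) :
    0 ≤ ∑ b, (6 * dotProduct (u (src b)) ((S b)ᵀ *ᵥ u (tgt b)) * (η (src b) ^ 2 + η (tgt b) ^ 2) -
      4 * η (src b) * η (tgt b) *
        (∑ a : Fin 4, S b a a - dotProduct (S b *ᵥ ((S b)ᵀ *ᵥ u (tgt b))) ((S b)ᵀ *ᵥ u (tgt b)) -
          dotProduct (u (src b)) (S b *ᵥ u (src b)) +
            dotProduct (u (src b)) ((S b)ᵀ *ᵥ u (tgt b)) * dotProduct (u (src b)) (S b *ᵥ ((S b)ᵀ *ᵥ u (tgt b))))) := by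
  have hq : ∀ b, dotProduct ((S b)ᵀ *ᵥ u (tgt b)) ((S b)ᵀ *ᵥ u (tgt b)) = 1 := fun b => by
    rw [transpose_mulVec_dot (hS b), hu]
  have hfield : ∀ a : Fin 4,
      ∑ b, (2 * dotProduct (η (src b) • (Pi.single a 1 - dotProduct (Pi.single a 1) (u (src b)) • u (src b)))
              ((S b)ᵀ *ᵥ (η (tgt b) • (Pi.single a 1 - dotProduct (Pi.single a 1) (u (tgt b)) • u (tgt b)))) -
            dotProduct (u (src b)) ((S b)ᵀ *ᵥ u (tgt b)) *
              (dotProduct (η (src b) • (Pi.single a 1 - dotProduct (Pi.single a 1) (u (src b)) • u (src b)))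
                  (η (src b) • (Pi.single a 1 - dotProduct (Pi.single a 1) (u (src b)) • u (src b))) +
                dotProduct ((S b)ᵀ *ᵥ (η (tgt b) • (Pi.single a 1 - dotProduct (Pi.single a 1) (u (tgt b)) • u (tgt b))))
                  ((S b)ᵀ *ᵥ (η (tgt b) • (Pi.single a 1 - dotProduct (Pi.single a 1) (u (tgt b)) • u (tgt b)))))) ≤ 0 := by
    intro a
    refine sum_hessianForm_nonpos_of_forall_dot_le Finset.univ (fun b => u (src b)) (fun b => (S b)ᵀ *ᵥ u (tgt b))
      (fun b => η (src b) • (Pi.single a 1 - dotProduct (Pi.single a 1) (u (src b)) • u (src b)))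
      (fun b => (S b)ᵀ *ᵥ (η (tgt b) • (Pi.single a 1 - dotProduct (Pi.single a 1) (u (tgt b)) • u (tgt b)))) fun t => ?_
    have h := hmin a t
    simp only [transpose_mulVec_varPt (hS _)] at h
    exact h
  have hsum4 := Finset.sum_nonpos fun a (_ : a ∈ (Finset.univ : Finset (Fin 4))) => hfield a
  rw [Finset.sum_comm] at hsum4
  have hper : ∀ b, ∑ a : Fin 4,
      (2 * dotProduct (η (src b) • (Pi.single a 1 - dotProduct (Pi.single a 1) (u (src b)) • u (src b)))
          ((S b)ᵀ *ᵥ (η (tgt b) • (Pi.single a 1 - dotProduct (Pi.single a 1) (u (tgt b)) • u (tgt b)))) -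
        dotProduct (u (src b)) ((S b)ᵀ *ᵥ u (tgt b)) *
          (dotProduct (η (src b) • (Pi.single a 1 - dotProduct (Pi.single a 1) (u (src b)) • u (src b)))
              (η (src b) • (Pi.single a 1 - dotProduct (Pi.single a 1) (u (src b)) • u (src b))) +
            dotProduct ((S b)ᵀ *ᵥ (η (tgt b) • (Pi.single a 1 - dotProduct (Pi.single a 1) (u (tgt b)) • u (tgt b))))
              ((S b)ᵀ *ᵥ (η (tgt b) • (Pi.single a 1 - dotProduct (Pi.single a 1) (u (tgt b)) • u (tgt b)))))) =
      2 * η (src b) * η (tgt b) *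
          (∑ a : Fin 4, S b a a - dotProduct (S b *ᵥ ((S b)ᵀ *ᵥ u (tgt b))) ((S b)ᵀ *ᵥ u (tgt b)) -
            dotProduct (u (src b)) (S b *ᵥ u (src b)) +
              dotProduct (u (src b)) ((S b)ᵀ *ᵥ u (tgt b)) * dotProduct (u (src b)) (S b *ᵥ ((S b)ᵀ *ᵥ u (tgt b)))) -
        3 * dotProduct (u (src b)) ((S b)ᵀ *ᵥ u (tgt b)) * (η (src b) ^ 2 + η (tgt b) ^ 2) := by
    intro b
    rw [← sum_bondHessian_twist_eq (hS b) (u (src b)) ((S b)ᵀ *ᵥ u (tgt b)) (hu _) (hq b) (η (src b)) (η (tgt b))]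
    refine Finset.sum_congr rfl fun a _ => ?_
    rw [Matrix.mulVec_smul, transpose_mulVec_tang (hS b)]
    simp only [smul_dotProduct, dotProduct_smul, smul_eq_mul]
    ring
  simp only [hper] at hsum4
  have : ∑ b, (6 * dotProduct (u (src b)) ((S b)ᵀ *ᵥ u (tgt b)) * (η (src b) ^ 2 + η (tgt b) ^ 2) -
      4 * η (src b) * η (tgt b) *
        (∑ a : Fin 4, S b a a - dotProduct (S b *ᵥ ((S b)ᵀ *ᵥ u (tgt b))) ((S b)ᵀ *ᵥ u (tgt b)) -
          dotProduct (u (src b)) (S b *ᵥ u (src b)) +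
            dotProduct (u (src b)) ((S b)ᵀ *ᵥ u (tgt b)) * dotProduct (u (src b)) (S b *ᵥ ((S b)ᵀ *ᵥ u (tgt b))))) =
      (-2) * ∑ b, (2 * η (src b) * η (tgt b) *
          (∑ a : Fin 4, S b a a - dotProduct (S b *ᵥ ((S b)ᵀ *ᵥ u (tgt b))) ((S b)ᵀ *ᵥ u (tgt b)) -
            dotProduct (u (src b)) (S b *ᵥ u (src b)) +
              dotProduct (u (src b)) ((S b)ᵀ *ᵥ u (tgt b)) * dotProduct (u (src b)) (S b *ᵥ ((S b)ᵀ *ᵥ u (tgt b)))) -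
        3 * dotProduct (u (src b)) ((S b)ᵀ *ᵥ u (tgt b)) * (η (src b) ^ 2 + η (tgt b) ^ 2)) := by
    rw [Finset.mul_sum]
    exact Finset.sum_congr rfl fun b _ => by ring
  rw [this]
  nlinarith [hsum4]

/-- ★★★ **THE SHARP-CONSTANT TWISTED GRAPH INEQUALITY** (`0 < ε`, `η ≥ 0`): under the same minimality,
`Σ_b η_xη_y·e_b·(2 − ε∕2 + e_b) ≤ Σ_b [6c_b(η_x − η_y)² + η_xη_y·(4(4 − tr S_b) + (8∕ε)|S_b q_b − q_b|²)]` — i.e. after halving,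
`Σ ηη e(1 − ε∕4 + e∕2) ≤ 3Σ c(η_x−η_y)² + Σ ηη(2(4 − tr S_b) + (4∕ε)|S_bq_b − q_b|²)`: the FLAT constant `3` of ✓`graph_stability` up to `ε`, which is what
a log-cutoff ∕ tangent-map GAP test (`8π > 3π`, Schoen–Uhlenbeck `d(3) = 3`) needs; ✓`twisted_graph_stability` is the `ε`-free form with constant `6`.
(`sum_twisted_secondVariation_nonneg` + ✓`secondVariation_twist_le_eps` summed.) [cite: Xin1980, p.609–613] -/
theorem twisted_graph_stability_eps {V B : Type*} [Fintype B] (src tgt : B → V) (u : V → Fin 4 → ℝ) (hu : ∀ x, dotProduct (u x) (u x) = 1)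
    (S : B → Matrix (Fin 4) (Fin 4) ℝ) (hS : ∀ b, S b * (S b)ᵀ = 1) (η : V → ℝ) (hη : ∀ x, 0 ≤ η x) {ε : ℝ} (hε : 0 < ε)
    (hmin : ∀ (a : Fin 4) (t : ℝ),
      ∑ b, dotProduct
        ((Real.sqrt (1 + t ^ 2 * dotProduct (η (src b) • (Pi.single a 1 - dotProduct (Pi.single a 1) (u (src b)) • u (src b)))
            (η (src b) • (Pi.single a 1 - dotProduct (Pi.single a 1) (u (src b)) • u (src b)))))⁻¹ •
          (u (src b) + t • (η (src b) • (Pi.single a 1 - dotProduct (Pi.single a 1) (u (src b)) • u (src b)))))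
        ((S b)ᵀ *ᵥ ((Real.sqrt (1 + t ^ 2 * dotProduct (η (tgt b) • (Pi.single a 1 - dotProduct (Pi.single a 1) (u (tgt b)) • u (tgt b)))
            (η (tgt b) • (Pi.single a 1 - dotProduct (Pi.single a 1) (u (tgt b)) • u (tgt b)))))⁻¹ •
          (u (tgt b) + t • (η (tgt b) • (Pi.single a 1 - dotProduct (Pi.single a 1) (u (tgt b)) • u (tgt b)))))) ≤
      ∑ b, dotProduct (u (src b)) ((S b)ᵀ *ᵥ u (tgt b))) :
    ∑ b, η (src b) * η (tgt b) * dotProduct (u (src b) - (S b)ᵀ *ᵥ u (tgt b)) (u (src b) - (S b)ᵀ *ᵥ u (tgt b)) *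
        (2 - ε / 2 + dotProduct (u (src b) - (S b)ᵀ *ᵥ u (tgt b)) (u (src b) - (S b)ᵀ *ᵥ u (tgt b))) ≤
      ∑ b, (6 * dotProduct (u (src b)) ((S b)ᵀ *ᵥ u (tgt b)) * (η (src b) - η (tgt b)) ^ 2 +
        η (src b) * η (tgt b) * (4 * (4 - ∑ a : Fin 4, S b a a) +
          8 / ε * dotProduct (S b *ᵥ ((S b)ᵀ *ᵥ u (tgt b)) - (S b)ᵀ *ᵥ u (tgt b)) (S b *ᵥ ((S b)ᵀ *ᵥ u (tgt b)) - (S b)ᵀ *ᵥ u (tgt b)))) := by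
  have hq : ∀ b, dotProduct ((S b)ᵀ *ᵥ u (tgt b)) ((S b)ᵀ *ᵥ u (tgt b)) = 1 := fun b => by
    rw [transpose_mulVec_dot (hS b), hu]
  have hstab := sum_twisted_secondVariation_nonneg src tgt u hu S hS η hmin
  have hb : ∀ b, 6 * dotProduct (u (src b)) ((S b)ᵀ *ᵥ u (tgt b)) * (η (src b) ^ 2 + η (tgt b) ^ 2) -
      4 * η (src b) * η (tgt b) *
        (∑ a : Fin 4, S b a a - dotProduct (S b *ᵥ ((S b)ᵀ *ᵥ u (tgt b))) ((S b)ᵀ *ᵥ u (tgt b)) -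
          dotProduct (u (src b)) (S b *ᵥ u (src b)) +
            dotProduct (u (src b)) ((S b)ᵀ *ᵥ u (tgt b)) * dotProduct (u (src b)) (S b *ᵥ ((S b)ᵀ *ᵥ u (tgt b)))) ≤
      6 * dotProduct (u (src b)) ((S b)ᵀ *ᵥ u (tgt b)) * (η (src b) - η (tgt b)) ^ 2 -
        η (src b) * η (tgt b) * dotProduct (u (src b) - (S b)ᵀ *ᵥ u (tgt b)) (u (src b) - (S b)ᵀ *ᵥ u (tgt b)) *
          (2 - ε / 2 + dotProduct (u (src b) - (S b)ᵀ *ᵥ u (tgt b)) (u (src b) - (S b)ᵀ *ᵥ u (tgt b))) +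
        η (src b) * η (tgt b) * (4 * (4 - ∑ a : Fin 4, S b a a) +
          8 / ε * dotProduct (S b *ᵥ ((S b)ᵀ *ᵥ u (tgt b)) - (S b)ᵀ *ᵥ u (tgt b)) (S b *ᵥ ((S b)ᵀ *ᵥ u (tgt b)) - (S b)ᵀ *ᵥ u (tgt b))) :=
    fun b => secondVariation_twist_le_eps (hS b) (u (src b)) ((S b)ᵀ *ᵥ u (tgt b)) (hu _) (hq b) (hη _) (hη _) hε
  have hsum := Finset.sum_le_sum fun b (_ : b ∈ (Finset.univ : Finset B)) => hb b
  have hsplit : ∑ b, (6 * dotProduct (u (src b)) ((S b)ᵀ *ᵥ u (tgt b)) * (η (src b) - η (tgt b)) ^ 2 -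
        η (src b) * η (tgt b) * dotProduct (u (src b) - (S b)ᵀ *ᵥ u (tgt b)) (u (src b) - (S b)ᵀ *ᵥ u (tgt b)) *
          (2 - ε / 2 + dotProduct (u (src b) - (S b)ᵀ *ᵥ u (tgt b)) (u (src b) - (S b)ᵀ *ᵥ u (tgt b))) +
        η (src b) * η (tgt b) * (4 * (4 - ∑ a : Fin 4, S b a a) +
          8 / ε * dotProduct (S b *ᵥ ((S b)ᵀ *ᵥ u (tgt b)) - (S b)ᵀ *ᵥ u (tgt b)) (S b *ᵥ ((S b)ᵀ *ᵥ u (tgt b)) - (S b)ᵀ *ᵥ u (tgt b)))) =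
      ∑ b, (6 * dotProduct (u (src b)) ((S b)ᵀ *ᵥ u (tgt b)) * (η (src b) - η (tgt b)) ^ 2 +
        η (src b) * η (tgt b) * (4 * (4 - ∑ a : Fin 4, S b a a) +
          8 / ε * dotProduct (S b *ᵥ ((S b)ᵀ *ᵥ u (tgt b)) - (S b)ᵀ *ᵥ u (tgt b)) (S b *ᵥ ((S b)ᵀ *ᵥ u (tgt b)) - (S b)ᵀ *ᵥ u (tgt b)))) -
      ∑ b, η (src b) * η (tgt b) * dotProduct (u (src b) - (S b)ᵀ *ᵥ u (tgt b)) (u (src b) - (S b)ᵀ *ᵥ u (tgt b)) *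
        (2 - ε / 2 + dotProduct (u (src b) - (S b)ᵀ *ᵥ u (tgt b)) (u (src b) - (S b)ᵀ *ᵥ u (tgt b))) := by
    rw [← Finset.sum_sub_distrib]
    exact Finset.sum_congr rfl fun b _ => by ring
  rw [hsplit] at hsum
  linarith


end Summit.QuantumFields.YangMills.Theorems.PoincareLipschitzLeungXinTwistedSharp
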